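import Summits.BirchSwinnertonDyer.BirchSwinnertonDyer.Theorems.PrintCf2RubinValueTwoGoodTwistDictFrobeniusComparison
import Summits.BirchSwinnertonDyer.BirchSwinnertonDyer.Theorems.PrintCf2RubinValueTwoGoodTwistDictQuadSign
import Summits.BirchSwinnertonDyer.BirchSwinnertonDyer.Theorems.PrintCf2SplitBadTwoAvatarRigidity
import Literature.NumberTheory.GaloisRepresentations.AlgebraicHeckeCharacterNormValues
import Literature.NumberTheory.EllipticCurves.CanonicalPAdicHeightRestrictionProofs
import Literature.NumberTheory.EllipticCurves.OrdinaryPrimesProofs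
import HarnessLib

/-!
# Route C `PrintCf2RubinValueTwo`, crux `GoodTwistDictionaryAtTwo` (stmt-BirchSwinnertonDyer-23295), PART 2 / F2C:
# THE `2`-ADIC AVATAR OF `ψ_{W′}·ψ_W⁻¹` IS THE SIGN CHARACTER OF `√ε`

Cell `bsd-print-cf2`, width seat `bsd-line-cf2c-w2` g9 (prover-bsd-line-cf2c-w2-g9-0); Theses-free helper
`--supports stmt-BirchSwinnertonDyer-23295`. THEOREMS ONLY (no `def`, no named fact, no `sorry`); CONDITIONAL (displayed binder)
on the print `Deuring_exists_heckeCharacter_of_maximalCM`; nothing about BSD is asserted; no summit statement is proved by this seat;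
BSD is not proved by any of this.

SETTING: as in F2B (`GoodTwistDictFrobenius`): frame field `K`, member `W ≅ cm7^{(d)}`, good twist `W′ ≅ cm7^{(m)} ≅ W^{(ε)}` (globally
minimal, `ε` square-free), pinned type-`(1,0)` characters `ψ`, `ψ′`; `ι : ℚ̄₂ ≃ ℂ`; `r ∈ K̄` with `r² = ε`.

* §1 `absNorm_eq_of_frame` — **`N w = p` at split, `p²` at inert good places**, read off Deuring's clause (iv) and
  `‖ψ(ϖ_w)‖² = N w` (`HasInfinityType.norm_valueAtUniformizer_sq`, weight `1`); no ramification theory is used.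
* §2 `pow_half_sub_legendreSym_mem`, `pow_half_sq_sub_one_mem` — Euler's criterion in `𝓞 K` modulo `w ∣ p`:
  `ε^{(p−1)/2} ≡ (ε/p)`, `ε^{(p²−1)/2} ≡ 1`.
* §3 ★ `exists_sign_isPAdicAvatarOf_twist` — **there is a rank-one framed `g` over `ℚ̄₂` with entry `1` at the `σ` fixing `r`, `−1` at the
  others, and `IsPAdicAvatarOf ι (ψ′ * ψ⁻¹) g`**: at every `w` above a prime `p ∤ 2εΔ(W)Δ(W′)`, `g(Frob_w) = (ε/p)` or `1` (F1
  `hasFrobCharpolyAt_of_sign` with §1–§2) equals `ι⁻¹((ψ′ψ⁻¹)(ϖ_w))⁻¹` (F2B `valueAtUniformizer_mul_inv_eq`), so the avatar property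
  holds at almost all places (`AvatarRigidity.isPAdicAvatarOf_of_eventually`).

References: [SerreAbelianLadic1968] Ch. I §2.3, Ch. II §2.7; [IrelandRosen1990] Ch. 5 §1 Prop. 5.1.1; [SilvermanATAEC1994] Ch. II
Thm. 10.5 (b); [Weil1956] §1.
-/

set_option autoImplicit false
-- D-0017 layout: summit = sub-problem, so `Summit.BirchSwinnertonDyer.BirchSwinnertonDyer.…` repeats a path component.
set_option linter.dupNamespace false

noncomputable section

open scoped Classical Polynomial
open NumberField IsDedekindDomain Field WeierstrassCurve Polynomial
open Literature Literature.NumberTheory.GaloisRepresentations Literature.NumberTheory.EllipticCurves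
open Literature.NumberTheory.EllipticCurves.Rank1Residual
open Summit.BirchSwinnertonDyer.BirchSwinnertonDyer.Theorems.PrintCf2.GoodTwistDictQuadSign
open Summit.BirchSwinnertonDyer.BirchSwinnertonDyer.Theorems.PrintCf2.GoodTwistDictFrobenius

namespace Summit.BirchSwinnertonDyer.BirchSwinnertonDyer.Theorems.PrintCf2.GoodTwistDictSignAvatar

variable {K : Type} [Field K] [NumberField K]

/-! ## §1 Residue cardinalities of the good places, from Deuring's clause (iv) -/

section Frame

variable {d : ℤ} {W : WeierstrassCurve ℚ} [W.IsElliptic] [W.IsGloballyMinimal] {C : VariableChange ℚ}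
  {v vbar : HeightOneSpectrum (𝓞 K)} {ψ : HeckeCharacter K}

/-- **`N w = p²` if `c • w = w`, `N w = p` otherwise**, at a place `w ∣ p` of good reduction of the member `W`: Deuring's clause (iv)
gives `ψ(ϖ_w) = −p`, resp. `ψ(ϖ_w)ψ(ϖ_{cw}) = p`, and a type-`(1,0)` character has `‖ψ(ϖ_w)‖² = N w` at unramified places
(`HasInfinityType.norm_valueAtUniformizer_sq`), `N(c • w) = N w`. [cite: SilvermanATAEC1994, Ch. II Thm. 10.5 (b)] [cite: Weil1956, §1] -/
theorem absNorm_eq_of_frame (hDe : Deuring_exists_heckeCharacter_of_maximalCM) (hK : IsImaginaryQuadratic K)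
    (hd0 : d ≠ 0) (hCW : C • W = cm7.quadraticTwist (d : ℚ))
    (hv : ((2 : ℕ) : 𝓞 K) ∈ v.asIdeal) (hvbar : ((2 : ℕ) : 𝓞 K) ∈ vbar.asIdeal) (hne : vbar ≠ v)
    (c : K ≃ₐ[ℚ] K) (hc : c ≠ 1)
    (hψ : ψ.HasInfinityType (fun _ ↦ 1) (fun _ ↦ 0)) (hψL : ∀ s : ℂ, 3 / 2 < s.re → heckeLFunction ψ s = W.LSeries s)
    {p : ℕ} [Fact p.Prime] (hpW : W.HasGoodReductionAtPrime p) {w : HeightOneSpectrum (𝓞 K)} (hpw : (p : 𝓞 K) ∈ w.asIdeal) :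
    Ideal.absNorm w.asIdeal = if c • w = w then p ^ 2 else p := by
  obtain ⟨-, hiv⟩ := FramePinning.frame_eq_deuring hDe hd0 hCW hK hv hvbar hne c hc hψ hψL
  obtain ⟨hw, hsp, hin⟩ := hiv p hpW w hpw
  -- `‖ψ(ϖ_u)‖² = N u` at every unramified `u`
  obtain ⟨e, hmod⟩ := ψ.exists_isModulus_of_ramified
  have hwt : ∀ u : InfinitePlace K, 2 * ((fun _ : InfinitePlace K ↦ (1 : ℤ)) u + (fun _ : InfinitePlace K ↦ (0 : ℤ)) u) =
      1 * (u.mult : ℤ) := fun u ↦ by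
    haveI := hK.2
    have hu : u.mult = 2 := by
      rw [InfinitePlace.mult, if_neg (InfinitePlace.not_isReal_iff_isComplex.mpr (IsTotallyComplex.isComplex u))]
    rw [hu]; norm_num
  have hnorm : ∀ u : HeightOneSpectrum (𝓞 K), ψ.IsUnramifiedAt u → ‖ψ.valueAtUniformizer u‖ ^ 2 = (Ideal.absNorm u.asIdeal : ℝ) :=
    fun u hu ↦ by
      have h := hψ.norm_valueAtUniformizer_sq hmod hwt (v := u)
        (fun hT ↦ ((HeckeCharacter.finite_ramifiedPlaces_holds ψ).mem_toFinset.mp hT) hu)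
      rwa [zpow_one] at h
  have hp0 : (0 : ℝ) ≤ p := Nat.cast_nonneg p
  by_cases hcw : c • w = w
  · -- inert: `ψ(ϖ_w) = −p`
    rw [if_pos hcw]
    have h := hnorm w hw
    rw [(hin hcw).2, norm_neg, Complex.norm_natCast] at h
    exact_mod_cast h.symm
  · -- split: `ψ(ϖ_w)ψ(ϖ_{cw}) = p`, `N(cw) = N w`
    rw [if_neg hcw]
    have hfix : c • (p : 𝓞 K) = (p : 𝓞 K) := map_natCast (MulSemiringAction.toRingHom _ (𝓞 K) c) p
    have hpcw : (p : 𝓞 K) ∈ (c • w).asIdeal := by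
      rw [← hfix]
      exact (Literature.NumberTheory.Automorphic.HeightOneSpectrum.smul_mem_smul_asIdeal_iff c w _).mpr hpw
    obtain ⟨hcw', -, -⟩ := hiv p hpW (c • w) hpcw
    have h1 := hnorm w hw
    have h2 := hnorm (c • w) hcw'
    rw [Literature.NumberTheory.Automorphic.HeightOneSpectrum.absNorm_algEquiv_smul] at h2
    have hprod := (hsp hcw).2
    have hsq : ((Ideal.absNorm w.asIdeal : ℝ)) ^ 2 = (p : ℝ) ^ 2 := by
      have := congrArg (fun z : ℂ ↦ ‖z‖ ^ 2) hprod
      simp only [norm_mul, mul_pow, Complex.norm_natCast] at this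
      rw [h1, h2] at this
      rw [← this, sq]
    have habs : (Ideal.absNorm w.asIdeal : ℝ) = p := by
      rwa [sq_eq_sq₀ (Nat.cast_nonneg _) hp0] at hsq
    exact_mod_cast habs

end Frame

/-! ## §2 Euler's criterion modulo `w ∣ p` -/

/-- `ε^{(p−1)/2} ≡ (ε/p) (mod w)` for `w ∣ p` (Euler's criterion `legendreSym.eq_pow`, pushed from `ℤ/p` into `𝓞 K`).
[cite: IrelandRosen1990, Ch. 5 §1 Prop. 5.1.1] -/
theorem pow_half_sub_legendreSym_mem {p : ℕ} [Fact p.Prime] (ε : ℤ) {w : HeightOneSpectrum (𝓞 K)} (hpw : (p : 𝓞 K) ∈ w.asIdeal) :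
    ((ε : 𝓞 K)) ^ (p / 2) - ((legendreSym p ε : ℤ) : 𝓞 K) ∈ w.asIdeal := by
  have hdvd : (p : ℤ) ∣ ε ^ (p / 2) - legendreSym p ε := by
    rw [← ZMod.intCast_zmod_eq_zero_iff_dvd]
    push_cast
    rw [legendreSym.eq_pow, sub_self]
  obtain ⟨t, ht⟩ := hdvd
  have : ((ε : 𝓞 K)) ^ (p / 2) - ((legendreSym p ε : ℤ) : 𝓞 K) = (p : 𝓞 K) * (t : 𝓞 K) := by exact_mod_cast ht
  rw [this]
  exact w.asIdeal.mul_mem_right _ hpw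

/-- `ε^{(p²−1)/2} ≡ 1 (mod w)` for `w ∣ p`, `p ∤ 2ε` (`(p²−1)/2 = (p−1)/2 · (p+1)`, `(ε/p)^{p+1} = 1`).
[cite: IrelandRosen1990, Ch. 5 §1 Prop. 5.1.1] -/
theorem pow_half_sq_sub_one_mem {p : ℕ} [Fact p.Prime] {ε : ℤ} (hpε : ¬ (p : ℤ) ∣ 2 * ε) {w : HeightOneSpectrum (𝓞 K)}
    (hpw : (p : 𝓞 K) ∈ w.asIdeal) : ((ε : 𝓞 K)) ^ (p ^ 2 / 2) - 1 ∈ w.asIdeal := by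
  have hp : p.Prime := Fact.out
  have hp2 : p ≠ 2 := by
    rintro rfl
    exact hpε (dvd_mul_right 2 ε)
  obtain ⟨t, ht⟩ := hp.odd_of_ne_two hp2
  have hhalf : p / 2 = t := by omega
  have hsq : p ^ 2 / 2 = t * (p + 1) := by
    have : p ^ 2 = 2 * (t * (p + 1)) + 1 := by rw [ht]; ring
    omega
  have hne : (ε : ZMod p) ≠ 0 := by
    rw [Ne, ZMod.intCast_zmod_eq_zero_iff_dvd]
    exact fun h ↦ hpε (dvd_mul_of_dvd_right h 2)
  have hL : (legendreSym p ε) ^ (p + 1) = 1 := by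
    obtain ⟨u, hu⟩ : Even (p + 1) := by rw [ht]; exact ⟨t + 1, by ring⟩
    rcases legendreSym.eq_one_or_neg_one p hne with h | h
    · rw [h, one_pow]
    · rw [h, hu, ← two_mul, pow_mul, neg_one_sq, one_pow]
  have hdvd : (p : ℤ) ∣ ε ^ (p ^ 2 / 2) - 1 := by
    have h1 : (p : ℤ) ∣ ε ^ (p / 2) - legendreSym p ε := by
      rw [← ZMod.intCast_zmod_eq_zero_iff_dvd]
      push_cast
      rw [legendreSym.eq_pow, sub_self]
    have h2 := h1.trans (sub_dvd_pow_sub_pow (ε ^ (p / 2)) (legendreSym p ε : ℤ) (p + 1))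
    rwa [← pow_mul, hhalf, ← hsq, hL] at h2
  obtain ⟨s, hs⟩ := hdvd
  have : ((ε : 𝓞 K)) ^ (p ^ 2 / 2) - 1 = (p : 𝓞 K) * (s : 𝓞 K) := by exact_mod_cast hs
  rw [this]
  exact w.asIdeal.mul_mem_right _ hpw

/-! ## §3 The avatar of `ψ′·ψ⁻¹` is the sign character of `√ε` -/

section Frame

variable {d m ε : ℤ} {W W' : WeierstrassCurve ℚ} [W.IsElliptic] [W.IsGloballyMinimal] [W'.IsElliptic] [W'.IsGloballyMinimal]
  {C C'' : VariableChange ℚ} {v vbar : HeightOneSpectrum (𝓞 K)} {ψ ψ' : HeckeCharacter K}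

/-- **The `2`-adic avatar of `ψ′·ψ⁻¹` is the sign character `g_ε` of `√ε`.** In the F2B frame (member `W ≅ cm7^{(d)}`, globally minimal good
twist `W′ ≅ cm7^{(m)} ≅ W^{(ε)}`, `ε` square-free, pinned type-`(1,0)` characters `ψ`, `ψ′`), for `ι : ℚ̄₂ ≃ ℂ` and `r² = ε` in `K̄`: there is
a rank-one framed `g : Γ_K →ₜ* GL₁(ℚ̄₂)` with entry `1` at the `σ` fixing `r` and `−1` at the others, and `IsPAdicAvatarOf ι (ψ′ * ψ⁻¹) g`.
GRANTED Deuring's theorem. [cite: SerreAbelianLadic1968, Ch. I §2.3, Ch. II §2.7] [cite: IrelandRosen1990, Ch. 14 §2 Prop. 14.2.2]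
[cite: SilvermanATAEC1994, Ch. II Thm. 10.5 (b)] -/
theorem exists_sign_isPAdicAvatarOf_twist (hDe : Deuring_exists_heckeCharacter_of_maximalCM) (hK : IsImaginaryQuadratic K)
    (hd0 : d ≠ 0) (hCW : C • W = cm7.quadraticTwist (d : ℚ)) (hm0 : m ≠ 0) (hCW' : C'' • W' = cm7.quadraticTwist (m : ℚ))
    (hε : Squarefree ε) (htw : ∃ C₁ : VariableChange ℚ, C₁ • W' = W.quadraticTwist (ε : ℚ))
    (hv : ((2 : ℕ) : 𝓞 K) ∈ v.asIdeal) (hvbar : ((2 : ℕ) : 𝓞 K) ∈ vbar.asIdeal) (hne : vbar ≠ v)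
    (c : K ≃ₐ[ℚ] K) (hc : c ≠ 1)
    (hψ : ψ.HasInfinityType (fun _ ↦ 1) (fun _ ↦ 0)) (hψL : ∀ s : ℂ, 3 / 2 < s.re → heckeLFunction ψ s = W.LSeries s)
    (hψ' : ψ'.HasInfinityType (fun _ ↦ 1) (fun _ ↦ 0)) (hψ'L : ∀ s : ℂ, 3 / 2 < s.re → heckeLFunction ψ' s = W'.LSeries s)
    (ι : PadicAlgCl 2 ≃+* ℂ) {r : AlgebraicClosure K} (hr : r ^ 2 = (ε : AlgebraicClosure K)) :
    ∃ g : FramedGaloisRep K (PadicAlgCl 2) 1,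
      (∀ σ : absoluteGaloisGroup K, (σ • r = r → g σ = 1) ∧
        (σ • r = -r → ∀ i j : Fin 1, ((g σ : GL (Fin 1) (PadicAlgCl 2)) : Matrix (Fin 1) (Fin 1) (PadicAlgCl 2)) i j = -1)) ∧
      IsPAdicAvatarOf ι (ψ' * ψ⁻¹) g := by
  haveI : Fact (Nat.Prime 2) := ⟨Nat.prime_two⟩
  have hε0 : ε ≠ 0 := fun h ↦ by rw [h] at hε; exact not_squarefree_zero hε
  have hεO : ((ε : 𝓞 K)) ≠ 0 := by exact_mod_cast hε0
  have hr' : r ^ 2 = algebraMap (𝓞 K) (AlgebraicClosure K) (ε : 𝓞 K) := by rw [hr, map_intCast]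
  obtain ⟨g, hg⟩ := exists_framedGaloisRep_sign (PadicAlgCl 2) hεO hr'
  refine ⟨g, hg, AvatarRigidity.isPAdicAvatarOf_of_eventually ι ⟨_, _, hψ'.mul' hψ.inv⟩ ?_⟩
  -- the finite exceptional set: places above `2 ε Δ(W) Δ(W′)`
  set N : ℤ := 2 * ε * W.minimalDiscriminantInt * W'.minimalDiscriminantInt with hNdef
  have hΔ : W.minimalDiscriminantInt ≠ 0 := minimalDiscriminantInt_ne_zero W
  have hΔ' : W'.minimalDiscriminantInt ≠ 0 := minimalDiscriminantInt_ne_zero W'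
  have hN0 : N ≠ 0 := mul_ne_zero (mul_ne_zero (mul_ne_zero two_ne_zero hε0) hΔ) hΔ'
  have hNnat : N.natAbs ≠ 0 := Int.natAbs_ne_zero.mpr hN0
  have hfin := IsDedekindDomain.HeightOneSpectrum.finite_setOf_natCast_mem (R := 𝓞 K) hNnat
  refine (hfin.eventually_cofinite_notMem).mono fun w hwN _h2 _hunr 𝔓 h𝔓 Φ hΦ ↦ ?_
  -- the rational prime `p` below `w`: `p ∤ N`
  obtain ⟨p, hp, hpw⟩ := Literature.NumberTheory.EllipticCurves.exists_prime_natCast_mem_asIdeal w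
  haveI : Fact p.Prime := ⟨hp⟩
  have hpN : ¬ (p : ℤ) ∣ N := by
    intro hdvd
    apply hwN
    change ((N.natAbs : ℕ) : 𝓞 K) ∈ w.asIdeal
    obtain ⟨t, ht⟩ := Int.natAbs_dvd_natAbs.mpr hdvd
    rw [ht, Nat.cast_mul]
    exact w.asIdeal.mul_mem_right _ hpw
  have hpε : ¬ (p : ℤ) ∣ 2 * ε := fun h ↦ hpN (by rw [hNdef, mul_assoc]; exact h.mul_right _)
  have hpW : W.HasGoodReductionAtPrime p :=
    WeierstrassCurve.hasGoodReductionAtPrime_of_not_dvd W p fun h ↦ hpN (by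
      rw [hNdef]; exact (h.mul_left _).mul_right _)
  have hpW' : W'.HasGoodReductionAtPrime p :=
    WeierstrassCurve.hasGoodReductionAtPrime_of_not_dvd W' p fun h ↦ hpN (by rw [hNdef]; exact h.mul_left _)
  have h2w : (2 : 𝓞 K) ∉ w.asIdeal := by
    intro h2
    apply hpε
    have h21 : ((2 : ℕ) : 𝓞 K) ∈ w.asIdeal := by exact_mod_cast h2
    by_cases hp2 : p = 2
    · subst hp2; exact dvd_mul_right 2 ε
    · exfalso
      have hcop : Nat.Coprime 2 p := (Nat.coprime_primes Nat.prime_two hp).mpr (Ne.symm hp2)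
      obtain ⟨a, b, hab⟩ := Nat.isCoprime_iff_coprime.mpr hcop
      apply w.isPrime.ne_top
      rw [Ideal.eq_top_iff_one]
      have : (1 : 𝓞 K) = (a : 𝓞 K) * ((2 : ℕ) : 𝓞 K) + (b : 𝓞 K) * (p : 𝓞 K) := by exact_mod_cast hab.symm
      rw [this]
      exact w.asIdeal.add_mem (w.asIdeal.mul_mem_left _ h21) (w.asIdeal.mul_mem_left _ hpw)
  have hεw : ((ε : 𝓞 K)) ∉ w.asIdeal := by
    intro hεw'
    apply hpε
    -- `p ∣ ε`: the ideal `(p, ε) ⊆ w` is proper, so `gcd(p, ε) ≠ 1`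
    have hg : ¬ IsCoprime (p : ℤ) ε := by
      rintro ⟨a, b, hab⟩
      apply w.isPrime.ne_top
      rw [Ideal.eq_top_iff_one]
      have : (1 : 𝓞 K) = (a : 𝓞 K) * (p : 𝓞 K) + (b : 𝓞 K) * (ε : 𝓞 K) := by exact_mod_cast hab.symm
      rw [this]
      exact w.asIdeal.add_mem (w.asIdeal.mul_mem_left _ hpw) (w.asIdeal.mul_mem_left _ hεw')
    have hdvd : (p : ℤ) ∣ ε := by
      by_contra hnd
      exact hg ((Nat.prime_iff_prime_int.mp hp).coprime_iff_not_dvd.mpr hnd)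
    exact dvd_mul_of_dvd_right hdvd 2
  -- the value of `(ψ′ψ⁻¹)(ϖ_w)` and the residue cardinality
  have hval := valueAtUniformizer_mul_inv_eq hDe hK hd0 hCW hm0 hCW' hε htw hv hvbar hne c hc hψ hψL hψ' hψ'L hpε hpW hpW' hpw
  have hNw := absNorm_eq_of_frame hDe hK hd0 hCW hv hvbar hne c hc hψ hψL hpW hpw
  have hcard : Nat.card (𝓞 K ⧸ w.asIdeal) = Ideal.absNorm w.asIdeal := by
    rw [Ideal.absNorm_apply, Submodule.cardQuot_apply]
  have hp2 : p ≠ 2 := by rintro rfl; exact hpε (dvd_mul_right 2 ε)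
  obtain ⟨t, ht⟩ := hp.odd_of_ne_two hp2
  by_cases hcw : c • w = w
  · -- inert: `N w = p²`, Euler sign `1`, value `1`
    rw [if_pos hcw] at hval hNw
    have hk : Nat.card (𝓞 K ⧸ w.asIdeal) = 2 * (p ^ 2 / 2) + 1 := by
      rw [hcard, hNw]
      have : p ^ 2 = 2 * (2 * t ^ 2 + 2 * t) + 1 := by rw [ht]; ring
      omega
    have hfrob := hasFrobCharpolyAt_of_sign h2w hεw hk (s := 1) (Or.inl rfl) (by
      simpa using pow_half_sq_sub_one_mem (K := K) hpε hpw) hr' hg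
    rw [(FramedGaloisRep.hasFrobCharpolyAt_iff_of_rank_one g w _).mp hfrob 𝔓 h𝔓 Φ hΦ, hval]
    simp
  · -- split: `N w = p`, Euler sign `(ε/p)`, value `(ε/p)`
    rw [if_neg hcw] at hval hNw
    have hk : Nat.card (𝓞 K ⧸ w.asIdeal) = 2 * (p / 2) + 1 := by rw [hcard, hNw]; omega
    have hne0 : (ε : ZMod p) ≠ 0 := by
      rw [Ne, ZMod.intCast_zmod_eq_zero_iff_dvd]
      exact fun h ↦ hpε (dvd_mul_of_dvd_right h 2)
    have hs : (legendreSym p ε : ℤ) = 1 ∨ (legendreSym p ε : ℤ) = -1 := legendreSym.eq_one_or_neg_one p hne0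
    have hfrob := hasFrobCharpolyAt_of_sign h2w hεw hk hs (pow_half_sub_legendreSym_mem ε hpw) hr' hg
    rw [(FramedGaloisRep.hasFrobCharpolyAt_iff_of_rank_one g w _).mp hfrob 𝔓 h𝔓 Φ hΦ, hval, map_intCast]
    rcases hs with h | h <;> simp [h]

end Frame

end Summit.BirchSwinnertonDyer.BirchSwinnertonDyer.Theorems.PrintCf2.GoodTwistDictSignAvatar

end
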